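import Literature.Computability.AlgebraicComplexity.ConstantFreeCircuits
import Literature.Computability.AlgebraicComplexity.HrubesSensitiveMonotoneProofs
import HarnessLib

/-!
# AnyonJets — crux `JetConstantElim` (stmt-ValiantsHypothesis-16737), stub `stub_integralMultiple`:
# padding plumbing (growing a sign-constant gate list; powers `z^(2^t)`; binary lifting)

Route-independent toolkit (no `Theses` import, no definitions, no `sorry`) for the
denominator-clearing lemma of `AnyonJetsJetConstantElimPaddingHomogenisation.lean`: the rational
bounded-height slice of the OPEN stub `stub_integralMultiple` of line
`Cruxes/JetConstantElim/Lines/birth.lean` ("denominators are absorbed by the multiplier `M`").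

A constant-free (sign-constant, fan-in-two) gate list over `ℤ` is grown at the end, in the
"available operand" style of the tree's `Hrubes2020` / `FormalHomogenisation` plumbing, but
tracking `HasSignConstants` instead of plainness / formal degree:

* `sc_avail_mono`, `sc_avail_X`, `sc_avail_C`, `sc_extend_prod`, `sc_extend_sum` — availability of a
  polynomial by a backward-referring sign-constant operand; one product / one signed-sum gate.
* `pad_powers` — the powers `z^(2^t)`, `t ≤ T`, of the padding variable `z = X none` by `T`
  squarings.
* `pad_mulZ`, `pad_lift` — binary lifting: with `z^(2^t)` available for `t ≤ T`, an available `H`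
  with `κ_w(H) = z^e · R` becomes an available `H'` with `κ_w(H') = z^(e+d) · R`, any `d < 2^(T+1)`,
  in `≤ T + 1` product gates; here `κ_w` is the substitution `X (some i) ↦ X (some i) · z^(w i)`,
  `z ↦ z` through which the homogenisation invariant is expressed (no homogenisation operator).

Honest framing: bookkeeping; nothing here bears on the open stub's content (degree and height of
the field of definition of near-optimal circuits) or on VP ≠ VNP.

References: V. Strassen, *Vermeidung von Divisionen*, Crelle 264 (1973) (padding by a
homogenising variable); P. Bürgisser, *Completeness and Reduction in Algebraic Complexity Theory*
(2000), Def. 2.1, §4.1.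
-/

noncomputable section

-- single-conjunct layout: Sub = Summit, duplicated namespace component intended
set_option linter.dupNamespace false

namespace Summit.ValiantsHypothesis.ValiantsHypothesis.Theorems.AnyonJets.JetConstantElim

open MvPolynomial Literature.Computability.AlgebraicComplexity
open Literature.Computability.AlgebraicComplexity.ArithCircuit

/-! ### Growing a sign-constant fan-in-two gate list (availability plumbing) -/

section Plumbing

variable {τ : Type*}

/-- Availability of a polynomial by a sign-constant operand referring backwards persists when the
gate list grows. [cite: Burgisser2000, Def. 2.1] -/
theorem sc_avail_mono {gs gs' : List (Gate ℤ τ)} (h : gs <+: gs') {p : MvPolynomial τ ℤ}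
    (hp : ∃ u : Operand ℤ τ, u.RefsBelow gs.length ∧ u.HasSignConstants ∧
      u.eval (gateValues gs) = p) :
    ∃ u : Operand ℤ τ, u.RefsBelow gs'.length ∧ u.HasSignConstants ∧
      u.eval (gateValues gs') = p := by
  obtain ⟨u, hu, hs, rfl⟩ := hp
  exact ⟨u, Hrubes2020.refsBelow_mono h.length_le hu, hs, Hrubes2020.operand_eval_of_prefix h hu⟩

/-- A variable is available in every gate list. [cite: Burgisser2000, Def. 2.1] -/
theorem sc_avail_X (gs : List (Gate ℤ τ)) (i : τ) :
    ∃ u : Operand ℤ τ, u.RefsBelow gs.length ∧ u.HasSignConstants ∧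
      u.eval (gateValues gs) = X i :=
  ⟨.var i, trivial, trivial, rfl⟩

/-- A sign constant is available in every gate list. [cite: Burgisser2000, §1.4] -/
theorem sc_avail_C (gs : List (Gate ℤ τ)) {c : ℤ} (hc : IsSignConstant c) :
    ∃ u : Operand ℤ τ, u.RefsBelow gs.length ∧ u.HasSignConstants ∧
      u.eval (gateValues gs) = C c :=
  ⟨.const c, trivial, hc, rfl⟩

/-- The operand referring to a freshly appended gate evaluates to that gate's value.
[cite: Burgisser2000, Def. 2.1] -/
theorem sc_eval_gate_length (gs : List (Gate ℤ τ)) (g : Gate ℤ τ) :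
    Operand.eval (gateValues (gs ++ [g])) (Operand.gate gs.length : Operand ℤ τ) =
      g.eval (gateValues gs) := by
  rw [gateValues_append_singleton]
  have hl := gateValues_length (k := ℤ) gs
  simp [Operand.eval, List.getD_eq_getElem?_getD, hl]

/-- Appending one product gate `p * q` of two available polynomials keeps the list fan-in-two and
sign-constant and makes `p * q` available. [cite: Burgisser2000, Def. 2.1] -/
theorem sc_extend_prod {gs : List (Gate ℤ τ)}
    (hg : ∀ g ∈ gs, g.fanIn ≤ 2 ∧ g.HasSignConstants) {p q : MvPolynomial τ ℤ}
    (hp : ∃ u : Operand ℤ τ, u.RefsBelow gs.length ∧ u.HasSignConstants ∧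
      u.eval (gateValues gs) = p)
    (hq : ∃ u : Operand ℤ τ, u.RefsBelow gs.length ∧ u.HasSignConstants ∧
      u.eval (gateValues gs) = q) :
    ∃ gs' : List (Gate ℤ τ), gs <+: gs' ∧ (∀ g ∈ gs', g.fanIn ≤ 2 ∧ g.HasSignConstants) ∧
      gs'.length = gs.length + 1 ∧
      ∃ u : Operand ℤ τ, u.RefsBelow gs'.length ∧ u.HasSignConstants ∧
        u.eval (gateValues gs') = p * q := by
  obtain ⟨up, hup, hsp, rfl⟩ := hp
  obtain ⟨uq, huq, hsq, rfl⟩ := hq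
  refine ⟨gs ++ [Gate.prod [up, uq]], List.prefix_append _ _, ?_, by simp, .gate gs.length,
    by simp [Operand.RefsBelow], trivial, ?_⟩
  · intro g hg'
    rcases List.mem_append.mp hg' with h | h
    · exact hg g h
    · simp only [List.mem_singleton] at h
      subst h
      refine ⟨by simp [Gate.fanIn, Gate.args], ?_⟩
      intro u hu
      simp only [List.mem_cons, List.mem_nil_iff, or_false] at hu
      rcases hu with rfl | rfl <;> assumption
  · rw [sc_eval_gate_length]
    simp [Gate.eval]

/-- Appending one weighted-sum gate `a • p + b • q` with sign coefficients keeps the list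
fan-in-two and sign-constant and makes `a • p + b • q` available. [cite: Burgisser2000, Def. 2.1] -/
theorem sc_extend_sum {gs : List (Gate ℤ τ)}
    (hg : ∀ g ∈ gs, g.fanIn ≤ 2 ∧ g.HasSignConstants) {a b : ℤ} (ha : IsSignConstant a)
    (hb : IsSignConstant b) {p q : MvPolynomial τ ℤ}
    (hp : ∃ u : Operand ℤ τ, u.RefsBelow gs.length ∧ u.HasSignConstants ∧
      u.eval (gateValues gs) = p)
    (hq : ∃ u : Operand ℤ τ, u.RefsBelow gs.length ∧ u.HasSignConstants ∧
      u.eval (gateValues gs) = q) :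
    ∃ gs' : List (Gate ℤ τ), gs <+: gs' ∧ (∀ g ∈ gs', g.fanIn ≤ 2 ∧ g.HasSignConstants) ∧
      gs'.length = gs.length + 1 ∧
      ∃ u : Operand ℤ τ, u.RefsBelow gs'.length ∧ u.HasSignConstants ∧
        u.eval (gateValues gs') = a • p + b • q := by
  obtain ⟨up, hup, hsp, rfl⟩ := hp
  obtain ⟨uq, huq, hsq, rfl⟩ := hq
  refine ⟨gs ++ [Gate.sum [(a, up), (b, uq)]], List.prefix_append _ _, ?_, by simp,
    .gate gs.length, by simp [Operand.RefsBelow], trivial, ?_⟩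
  · intro g hg'
    rcases List.mem_append.mp hg' with h | h
    · exact hg g h
    · simp only [List.mem_singleton] at h
      subst h
      refine ⟨by simp [Gate.fanIn, Gate.args], ?_⟩
      intro x hx
      simp only [List.mem_cons, List.mem_nil_iff, or_false] at hx
      rcases hx with rfl | rfl
      · exact ⟨ha, hsp⟩
      · exact ⟨hb, hsq⟩
  · rw [sc_eval_gate_length]
    simp [Gate.eval]

end Plumbing

/-! ### Padding homogenisation of a constant-free circuit

For a fan-in-two sign-constant circuit `Γ` over `ℤ` in variables `ι` and a weight `w : ι → ℕ`,
`w ≤ 1`, we build a fan-in-two sign-constant circuit over `Option ι` (`none` = the padding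
variable `z`) whose value `H` satisfies `κ_w(H) = z^(2^S) · Γ.eval` (`S = size Γ`), where `κ_w`
is the ring map `X (some i) ↦ X (some i) · z^(w i)`, `z ↦ z`: every gate `j` of `Γ` is re-computed
"at exponent `2^(j+1)`", operands being lifted by products with the precomputed powers
`z^(2^t)` along the binary expansion of the exponent gap. No homogenisation OPERATOR is needed:
the invariant is stated through `κ_w`. [folklore; Bürgisser 2000 §2.1, Strassen 1973 (padding)] -/

section PaddingLift

variable {ι : Type*}

/-- The powers `z^(2^t)`, `t ≤ T`, by `T` squarings. [folklore] -/
theorem pad_powers (gs : List (Gate ℤ (Option ι)))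
    (hg : ∀ g ∈ gs, g.fanIn ≤ 2 ∧ g.HasSignConstants) (T : ℕ) :
    ∃ gs' : List (Gate ℤ (Option ι)), gs <+: gs' ∧ (∀ g ∈ gs', g.fanIn ≤ 2 ∧ g.HasSignConstants) ∧
      gs'.length ≤ gs.length + T ∧
      ∀ t ≤ T, ∃ u : Operand ℤ (Option ι), u.RefsBelow gs'.length ∧ u.HasSignConstants ∧
        u.eval (gateValues gs') = X none ^ 2 ^ t := by
  induction T with
  | zero =>
    refine ⟨gs, List.prefix_rfl, hg, by simp, fun t ht => ?_⟩
    obtain rfl : t = 0 := by omega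
    simpa using sc_avail_X gs none
  | succ T ih =>
    obtain ⟨gs₁, hpre₁, hg₁, hlen₁, hZ₁⟩ := ih
    obtain ⟨gs₂, hpre₂, hg₂, hlen₂, hav⟩ := sc_extend_prod hg₁ (hZ₁ T le_rfl) (hZ₁ T le_rfl)
    refine ⟨gs₂, hpre₁.trans hpre₂, hg₂, by omega, fun t ht => ?_⟩
    rcases Nat.lt_or_ge t (T + 1) with hlt | hge
    · exact sc_avail_mono hpre₂ (hZ₁ t (by omega))
    · obtain rfl : t = T + 1 := by omega
      obtain ⟨u, hu, hs, he⟩ := hav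
      exact ⟨u, hu, hs, by rw [he, ← pow_add, ← two_mul, ← pow_succ']⟩

/-- One padding step: multiply an available `H` with `κ_w(H) = z^e · R` by the available power
`z^(2^t)`. [folklore] -/
theorem pad_mulZ (w : ι → ℕ) {gs : List (Gate ℤ (Option ι))}
    (hg : ∀ g ∈ gs, g.fanIn ≤ 2 ∧ g.HasSignConstants) {t : ℕ}
    (hZ : ∃ u : Operand ℤ (Option ι), u.RefsBelow gs.length ∧ u.HasSignConstants ∧
      u.eval (gateValues gs) = X none ^ 2 ^ t)
    {H R : MvPolynomial (Option ι) ℤ} {e : ℕ}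
    (hH : ∃ u : Operand ℤ (Option ι), u.RefsBelow gs.length ∧ u.HasSignConstants ∧
      u.eval (gateValues gs) = H)
    (hκ : aeval (fun o : Option ι => Option.elim o (X none) (fun i => X (some i) * X none ^ w i)) H =
      X none ^ e * R) :
    ∃ gs' : List (Gate ℤ (Option ι)), gs <+: gs' ∧ (∀ g ∈ gs', g.fanIn ≤ 2 ∧ g.HasSignConstants) ∧
      gs'.length = gs.length + 1 ∧
      ∃ H' : MvPolynomial (Option ι) ℤ,
        (∃ u : Operand ℤ (Option ι), u.RefsBelow gs'.length ∧ u.HasSignConstants ∧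
          u.eval (gateValues gs') = H') ∧
        aeval (fun o : Option ι => Option.elim o (X none) (fun i => X (some i) * X none ^ w i)) H' =
          X none ^ (e + 2 ^ t) * R := by
  obtain ⟨gs', hpre, hg', hlen, hav⟩ := sc_extend_prod hg hH hZ
  refine ⟨gs', hpre, hg', hlen, H * X none ^ 2 ^ t, hav, ?_⟩
  rw [map_mul, map_pow, aeval_X, hκ]
  simp only [Option.elim]
  ring

/-- Binary lifting: with `z^(2^t)` available for `t ≤ T`, an available `H` with `κ_w(H) = z^e · R`
is lifted to an available `H'` with `κ_w(H') = z^(e+d) · R` for any `d < 2^(T+1)`, in at most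
`T + 1` product gates. [folklore] -/
theorem pad_lift (w : ι → ℕ) (T : ℕ) :
    ∀ (d : ℕ), d < 2 ^ (T + 1) → ∀ (gs : List (Gate ℤ (Option ι))),
      (∀ g ∈ gs, g.fanIn ≤ 2 ∧ g.HasSignConstants) →
      (∀ t ≤ T, ∃ u : Operand ℤ (Option ι), u.RefsBelow gs.length ∧ u.HasSignConstants ∧
        u.eval (gateValues gs) = X none ^ 2 ^ t) →
      ∀ (H R : MvPolynomial (Option ι) ℤ) (e : ℕ),
        (∃ u : Operand ℤ (Option ι), u.RefsBelow gs.length ∧ u.HasSignConstants ∧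
          u.eval (gateValues gs) = H) →
        aeval (fun o : Option ι => Option.elim o (X none) (fun i => X (some i) * X none ^ w i)) H =
          X none ^ e * R →
        ∃ gs' : List (Gate ℤ (Option ι)), gs <+: gs' ∧
          (∀ g ∈ gs', g.fanIn ≤ 2 ∧ g.HasSignConstants) ∧ gs'.length ≤ gs.length + (T + 1) ∧
          ∃ H' : MvPolynomial (Option ι) ℤ,
            (∃ u : Operand ℤ (Option ι), u.RefsBelow gs'.length ∧ u.HasSignConstants ∧
              u.eval (gateValues gs') = H') ∧
            aeval (fun o : Option ι => Option.elim o (X none) (fun i => X (some i) * X none ^ w i))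
              H' = X none ^ (e + d) * R := by
  induction T with
  | zero =>
    intro d hd gs hg hZ H R e hH hκ
    rcases Nat.lt_or_ge d 1 with h0 | h1
    · obtain rfl : d = 0 := by omega
      exact ⟨gs, List.prefix_rfl, hg, by omega, H, hH, by simpa using hκ⟩
    · obtain rfl : d = 1 := by
        have : d < 2 := by simpa using hd
        omega
      obtain ⟨gs', hpre, hg', hlen, H', hH', hκ'⟩ := pad_mulZ w hg (hZ 0 le_rfl) hH hκ
      exact ⟨gs', hpre, hg', by omega, H', hH', by simpa using hκ'⟩
  | succ T ih =>
    intro d hd gs hg hZ H R e hH hκ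
    rcases Nat.lt_or_ge d (2 ^ (T + 1)) with hlt | hge
    · obtain ⟨gs', hpre, hg', hlen, H', hH', hκ'⟩ :=
        ih d hlt gs hg (fun t ht => hZ t (by omega)) H R e hH hκ
      exact ⟨gs', hpre, hg', by omega, H', hH', hκ'⟩
    · obtain ⟨gs₁, hpre₁, hg₁, hlen₁, H₁, hH₁, hκ₁⟩ := pad_mulZ w hg (hZ (T + 1) le_rfl) hH hκ
      have hd' : d - 2 ^ (T + 1) < 2 ^ (T + 1) := by
        have : 2 ^ (T + 1 + 1) = 2 ^ (T + 1) + 2 ^ (T + 1) := by ring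
        omega
      obtain ⟨gs₂, hpre₂, hg₂, hlen₂, H₂, hH₂, hκ₂⟩ :=
        ih (d - 2 ^ (T + 1)) hd' gs₁ hg₁ (fun t ht => sc_avail_mono hpre₁ (hZ t (by omega)))
          H₁ R (e + 2 ^ (T + 1)) hH₁ hκ₁
      refine ⟨gs₂, hpre₁.trans hpre₂, hg₂, by omega, H₂, hH₂, ?_⟩
      rw [hκ₂]
      congr 2
      omega

end PaddingLift

end Summit.ValiantsHypothesis.ValiantsHypothesis.Theorems.AnyonJets.JetConstantElim

end
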